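import Summits.RiemannHypothesis.RiemannHypothesis.Theses.WeilRadar
import HarnessLib

/-!
# `WeilRadar.Assembly` (item stmt-RiemannHypothesis-24075) — glue closer

The assembly item of route `WeilRadar` (L51 «WEIL RADAR»), `TranslateMixWindow → RadarGrowth → RadarResidual → Summit.RiemannHypothesis`,
is literally the type of the route's deciding theorem `Theses.WeilRadar.closes` (which binds exactly the
route's other items and no `Assembly`), so the deciding theorem itself is the proof.
Cell rh-split (typer-3 g3 glue sweep, second pass).  Pure propositional glue; no analysis.
Nothing here bears on the truth of RH.
-/

set_option linter.dupNamespace false  -- the mandated namespace repeats `RiemannHypothesis`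

namespace Summit.RiemannHypothesis.RiemannHypothesis.Theorems.WeilRadar

/-- **`Assembly` (item stmt-RiemannHypothesis-24075) holds**: it is the type of the route's deciding
theorem `Theses.WeilRadar.closes`. [folklore] -/
theorem assembly_proof : Summit.RiemannHypothesis.RiemannHypothesis.Theses.WeilRadar.Assembly :=
  Summit.RiemannHypothesis.RiemannHypothesis.Theses.WeilRadar.closes

end Summit.RiemannHypothesis.RiemannHypothesis.Theorems.WeilRadar
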